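/-
Copyright (c) 2026 the pub-hodgecm-mathlib formalisation cell (harness21).  Prover seat hodgecm-mathlib-K2E1-p03 (g2), Track B ∕ K2-LIT (stream 29),
h413 = `stmt-HodgeConjecture-24833`, line `K2_E1_TraceFormulaBeta`, helper `K2E1GroundFieldChangeLocalRingIso` (dealer K2E1-plan (g0) BY-NAME DEAL (3)
2026-09-03T22:29:23Z, part 2): CONSTRUCTION of the isomorphism of local data `L ⊗ L⁺_𝔭 ≃ L' ⊗ L'⁺_𝔓` from a degree-one bijection of places, and
the fully discharged transport `U(H)(L⁺_𝔭) ≃ₜ* U(H)(L'⁺_𝔓)` of row 21.  2026-09-03.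
-/
import Summits.HodgeConjecture.HodgeConjecture.Theorems.K2E1GroundFieldChangeLocalIso   -- ★ p855341 (this seat): transport along an isomorphism of local data
import Literature.NumberTheory.Automorphic.QuadraticAdeleBaseChange                     -- ★ `toPlace_mem_adicCompletionIntegers_iff` (integrality along `ι_w`)
import HarnessLib

/-!
# h413 ∕ Track B «K2-LIT», line `K2_E1_TraceFormulaBeta`, row 21: THE ISOMORPHISM OF LOCAL DATA `Π_{w ∣ 𝔭} L_w ≃+* Π_{w' ∣ 𝔓} L'_{w'}` FROM A DEGREE-ONE
# BIJECTION OF PLACES, AND THE DISCHARGED TRANSPORT `U(H)(L⁺_𝔭) ≃ₜ* U(H)(L'⁺_𝔓)` (helper `K2E1GroundFieldChangeLocalRingIso`, part 2 of the BY-NAME DEAL (3) of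
# K2E1-plan (g0), `K2/STATUS.md` 2026-09-03T22:29:23Z; sequel of ★ `K2E1GroundFieldChangeLocalIso`)

Cell `pub/hodgecm-mathlib`, crux H413 = `stmt-HodgeConjecture-24833`, route `HCCMUnconditional`; chair K2-lead (g0), dealer K2E1-plan (g0).  THEOREMS ONLY (kernel
lane: no `def`, no `instance`, no `notation`, no named-fact hypothesis, no `sorry`; isomorphisms delivered as `∃`); lane `--supports stmt-HodgeConjecture-24833 --as helper`.

★ `K2E1GroundFieldChangeLocalIso` (p855341) transports the local unitary group, its integral level and its irreducible classes along an ISOMORPHISM OF LOCAL DATA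
`Φ : LocalRing L 𝔭 ≃+* LocalRing L' 𝔓` (bicontinuous, `Φ ∘ (c ⊗ 1) = (c' ⊗ 1) ∘ Φ`, `Φ(H ⊗ 1) = H' ⊗ 1`, integers matched).  THIS FILE CONSTRUCTS `Φ` for a
GROUND-FIELD CHANGE: CM fields `L ⊆ L'` (`[Algebra L L']`, e.g. `L' = L·K`, `K` real quadratic), finite places `𝔭` of `L⁺`, `𝔓` of `L'⁺`, and the ARITHMETIC INPUT of
row 21 in the form
  `β : PlacesOver L' 𝔓 ≃ PlacesOver L 𝔭`, `w' ∣ β w'` (`w'.under (𝓞 L) = β w'`), `e(w' | β w') = f(w' | β w') = 1`, `β (c̄'⁻¹ • w') = c̄⁻¹ • β w'`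
(at a place `𝔓 ∣ 𝔭` of degree one with `L' = L ⊗_{L⁺} L'⁺` every place of `L'` above `𝔓` is of degree one over the place of `L` below it and `w' ↦ w' ∩ L` is such a
bijection; ★ `K2E1RealQuadraticTwoPlacesAboveP` ∕ ★ `K2E1InfinitelyManySplitPlaces` supply the places).  Then (§3) `Φ := Π_{w'} ι_{β w', w'}` with
`ι_{w,w'} = ★ adicCompletionEquivOfDegreeOne L L' w w' : L_w ≃+* L'_{w'}`:
* `Φ x w' = ι (x (β w'))`; `Φ` and `Φ⁻¹` continuous (★ `adicCompletionHomeomorphOfDegreeOne`);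
* `Φ ∘ (c ⊗ 1) = (c' ⊗ 1) ∘ Φ` — the NATURALITY SQUARE `c̄'_{w'} ∘ ι_{w₁,w₁'} = ι_{w₂,w₂'} ∘ c̄_{w₁}` (§2, two continuous maps out of `L_{w₁}` agreeing on `L`, ★
  `adicCompletion.ext_of_coe`), resting on `algebraMap ∘ c̄ = c̄' ∘ algebraMap` — TRUE FOR EVERY EMBEDDING OF CM FIELDS (§1 `algebraMap_complexConj`: complex
  conjugation on a CM field is intertwined with complex conjugation by every complex embedding, Mathlib `IsCMField.complexEmbedding_complexConj`);
* `Φ (x ⊗ 1) = (algebraMap L L' x) ⊗ 1` (★ `adicCompletionEquivOfDegreeOne_coe`), so `Φ (H ⊗ 1) = (H.map (algebraMap L L')) ⊗ 1`;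
* `Φ` matches integers (★ `toPlace_mem_adicCompletionIntegers_iff`, `𝒪[L_w] = ` Mathlib's `adicCompletionIntegers` by compatibility of the valuations).
§4 feeds `Φ` to ★ `cm_letter_transport`: **`cm_letter_transport_of_places`** — `∃ e : (cmDatum L N H).Local 𝔭 ≃ₜ* (cmDatum L' N (H.map (algebraMap L L'))).Local 𝔓`
with `IrrClass.comap e` bijective, admissible ↔ admissible, `U(H)(𝒪_𝔭)`-spherical ↔ `U(H)(𝒪_𝔓)`-spherical; and `exists_cmDatum_local_equiv_of_places` (the
isomorphism with its matrix formula and `(cmLocalIntegralLevel …).map e = cmLocalIntegralLevel …`).  Row 21 «letter(L·K, 𝔓) ⇒ letter(L, 𝔭)» is thereby reduced to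
its place combinatorics (`β`).

HONEST LABEL.  HC_CM is proved only modulo the 7 printed citations (2 remaining named inputs: hLiu418 = `stmt-HodgeConjecture-24832`, h413 = `stmt-HodgeConjecture-24833`)
until rung 0 closes; this file proves no printed statement of [Rogawski1990] and is count-neutral.

## References
* [Rogawski1990] J. Rogawski, *Automorphic representations of unitary groups in three variables*, Ann. of Math. Stud. 123 (1990), §4.7 p. 66, §14.2 p. 232 — context.
* [CasselsFrohlichANT1967] J. W. S. Cassels, A. Fröhlich (eds.), *Algebraic Number Theory* (1967), Ch. II §§10–11 (`L ⊗_K K_v = Π_{w ∣ v} L_w`), Ch. VII §1.1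
  («`σ_w` is a `K_v`-isomorphism» — the naturality square).
* [FrohlichTaylor1990] A. Fröhlich, M. Taylor, *Algebraic Number Theory* (1991), Ch. III §1 (1.14)(a) (`[K_w : F_v] = e f`).
* [PlatonovRapinchuk1994] V. Platonov, A. Rapinchuk, *Algebraic Groups and Number Theory* (1994), §5.1.
-/

set_option autoImplicit false
set_option linter.dupNamespace false  -- the mandated namespace repeats the summit's segment (`HodgeConjecture.HodgeConjecture`)

noncomputable section

namespace Summit.HodgeConjecture.HodgeConjecture.Cruxes.H413.K2E1GroundFieldChangeLocalRingIso

open NumberField IsDedekindDomain Matrix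
open scoped MatrixGroups ValuativeRel
open Literature.NumberTheory.Automorphic Literature.NumberTheory.Automorphic.UnitaryGroup
open Summit.HodgeConjecture.HodgeConjecture.Cruxes.H413.K2E1GroundFieldChangeLocalIso

/-! ## §1 Every embedding of CM fields intertwines the complex conjugations -/

section Conj

variable (L L' : Type) [Field L] [NumberField L] [IsCMField L] [Field L'] [NumberField L'] [IsCMField L'] [Algebra L L']

/-- **`algebraMap L L' ∘ c̄ = c̄' ∘ algebraMap L L'`** for CM fields `L ⊆ L'`: for any complex embedding `φ'` of `L'`, `φ' ∘ algebraMap` is a complex embedding of `L`,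
and complex conjugation on a CM field is intertwined with complex conjugation by EVERY complex embedding (Mathlib `IsCMField.complexEmbedding_complexConj`);
`φ'` is injective. [folklore] -/
theorem algebraMap_complexConj (x : L) :
    algebraMap L L' (IsCMField.complexConj L x) = IsCMField.complexConj L' (algebraMap L L' x) := by
  let φ' : L' →+* ℂ := Classical.choice (inferInstance : Nonempty (L' →+* ℂ))
  apply φ'.injective
  rw [IsCMField.complexEmbedding_complexConj L' φ', ← RingHom.comp_apply, IsCMField.complexEmbedding_complexConj L (φ'.comp (algebraMap L L')) x,
    RingHom.comp_apply]

end Conj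

/-! ## §2 The naturality square: `c̄'_{w'} ∘ ι_{w₁, w₁'} = ι_{w₂, w₂'} ∘ c̄_{w₁}` -/

section Square

variable (L L' : Type) [Field L] [NumberField L] [Field L'] [NumberField L'] [Algebra L L']

/-- **Naturality of the local base change under conjugation**: for `σ ∈ Aut(L)`, `σ' ∈ Aut(L')` with `algebraMap ∘ σ = σ' ∘ algebraMap`, places `w₁' ∣ w₁`,
`w₂' ∣ w₂` with `σ • w₁ = w₂`, `σ' • w₁' = w₂'`: `σ'_{w₁'→w₂'} ∘ ι_{w₁,w₁'} = ι_{w₂,w₂'} ∘ σ_{w₁→w₂}` on `L_{w₁}` (two continuous maps agreeing on the dense `L`, ★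
`adicCompletion.ext_of_coe`; Cassels–Fröhlich VII §1.1). [cite: CasselsFrohlichANT1967, Ch. VII §1.1] -/
theorem galAdicCompletionMap_adicCompletionOfLiesOver_comm {F F' : Type} [Field F] [Field F'] [Algebra F L] [Algebra F' L']
    (σ : L ≃ₐ[F] L) (σ' : L' ≃ₐ[F'] L') (hσ : ∀ x : L, algebraMap L L' (σ x) = σ' (algebraMap L L' x))
    {w₁ w₂ : HeightOneSpectrum (𝓞 L)} {w₁' w₂' : HeightOneSpectrum (𝓞 L')} [w₁'.asIdeal.LiesOver w₁.asIdeal] [w₂'.asIdeal.LiesOver w₂.asIdeal]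
    (h : σ • w₁ = w₂) (h' : σ' • w₁' = w₂') (z : w₁.adicCompletion L) :
    galAdicCompletionMap σ' h' (adicCompletionOfLiesOver L L' w₁ w₁' z) = adicCompletionOfLiesOver L L' w₂ w₂' (galAdicCompletionMap σ h z) := by
  refine congrFun (HeightOneSpectrum.adicCompletion.ext_of_coe L w₁
    ((continuous_galAdicCompletionMap L' σ' h').comp (continuous_adicCompletionOfLiesOver L L' w₁ w₁'))
    ((continuous_adicCompletionOfLiesOver L L' w₂ w₂').comp (continuous_galAdicCompletionMap L σ h)) fun a => ?_) z
  simp only [Function.comp_apply, adicCompletionOfLiesOver_coe, galAdicCompletionMap_coe_algEquiv, hσ]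

end Square

/-! ## §3 The isomorphism of local data `Φ = Π_{w'} ι_{β w', w'}` from a degree-one bijection of places -/

section Construction

variable (L L' : Type) [Field L] [NumberField L] [IsCMField L] [Field L'] [NumberField L'] [IsCMField L'] [Algebra L L']
  (𝔭 : HeightOneSpectrum (𝓞 ↥(maximalRealSubfield L))) (𝔓 : HeightOneSpectrum (𝓞 ↥(maximalRealSubfield L')))
  (β : PlacesOver L' 𝔓 ≃ PlacesOver L 𝔭) (hβ : ∀ w' : PlacesOver L' 𝔓, (w'.1).under (𝓞 L) = (β w').1)
  (he : ∀ w' : PlacesOver L' 𝔓, (w'.1).asIdeal.ramificationIdx (𝓞 L) = 1)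
  (hf : ∀ w' : PlacesOver L' 𝔓, (w'.1).asIdeal.inertiaDeg (𝓞 L) = 1)

include hβ he hf in
omit [IsCMField L] [IsCMField L'] in
/-- **THE ISOMORPHISM OF LOCAL DATA** `Φ : Π_{w ∣ 𝔭} L_w ≃+* Π_{w' ∣ 𝔓} L'_{w'}`, `Φ x w' = ι_{β w', w'} (x (β w'))`, for a bijection `β` of the places above
`𝔓` and above `𝔭` with `w' ∣ β w'` of degree one (`e = f = 1`): componentwise ★ `adicCompletionEquivOfDegreeOne`, reindexed along `β`; `Φ` and `Φ⁻¹` are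
continuous (★ `adicCompletionHomeomorphOfDegreeOne`).  Delivered as `∃ Φ` with its formula (`ι = ★ toPlace`). [cite: FrohlichTaylor1990, Ch. III §1 (1.14)(a)]
[cite: CasselsFrohlichANT1967, Ch. II §10] -/
theorem exists_localRingEquiv :
    ∃ Φ : LocalRing L 𝔭 ≃+* LocalRing L' 𝔓, Continuous Φ ∧ Continuous Φ.symm ∧
      ∀ (x : LocalRing L 𝔭) (w' : PlacesOver L' 𝔓), Φ x w' = toPlace (β w').1 (⟨w'.1, hβ w'⟩ : PlacesOver L' (β w').1) (x (β w')) := by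
  let ι : ∀ w' : PlacesOver L' 𝔓, (β w').1.adicCompletion L ≃+* (w'.1).adicCompletion L' := fun w' =>
    haveI := PlacesOver.liesOver (E := L') (⟨w'.1, hβ w'⟩ : PlacesOver L' (β w').1)
    adicCompletionEquivOfDegreeOne L L' (β w').1 w'.1 (he w') (hf w')
  let Φ : LocalRing L 𝔭 ≃+* LocalRing L' 𝔓 :=
    (RingEquiv.piCongrLeft' (fun w : PlacesOver L 𝔭 => w.1.adicCompletion L) β.symm).trans (RingEquiv.piCongrRight ι)
  have hΦ : ∀ (x : LocalRing L 𝔭) (w' : PlacesOver L' 𝔓), Φ x w' = ι w' (x (β w')) := fun x w' => rfl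
  let ιₜ : ∀ w' : PlacesOver L' 𝔓, (β w').1.adicCompletion L ≃ₜ (w'.1).adicCompletion L' := fun w' =>
    haveI := PlacesOver.liesOver (E := L') (⟨w'.1, hβ w'⟩ : PlacesOver L' (β w').1)
    adicCompletionHomeomorphOfDegreeOne L L' (β w').1 w'.1 (he w') (hf w')
  let Ψ : LocalRing L 𝔭 ≃ₜ LocalRing L' 𝔓 :=
    (Homeomorph.piCongrLeft (Y := fun w : PlacesOver L 𝔭 => w.1.adicCompletion L) β).symm.trans (Homeomorph.piCongrRight ιₜ)
  have hΨ : ∀ x : LocalRing L 𝔭, Φ x = Ψ x := fun x => funext fun w' => rfl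
  have hc : Continuous Φ := by
    have h1 : (Φ : LocalRing L 𝔭 → LocalRing L' 𝔓) = Ψ := funext hΨ
    rw [h1]; exact Ψ.continuous
  have hc' : Continuous Φ.symm := by
    have h1 : (Φ.symm : LocalRing L' 𝔓 → LocalRing L 𝔭) = Ψ.symm := by
      funext y
      apply Φ.injective
      rw [Φ.apply_symm_apply, hΨ, Ψ.apply_symm_apply]
    rw [h1]; exact Ψ.symm.continuous
  exact ⟨Φ, hc, hc', hΦ⟩

omit [IsCMField L] [IsCMField L'] in
/-- Transport of `c̄_{u → β w'} (x u)` along an equality of places `u₁ = u₂` above `𝔭` (dependent rewriting helper). [folklore] -/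
theorem galAdicCompletionMap_congr_place {F : Type} [Field F] [Algebra F L] (σ : L ≃ₐ[F] L) (x : LocalRing L 𝔭) {u₁ u₂ : PlacesOver L 𝔭}
    (h12 : u₁ = u₂) {w : HeightOneSpectrum (𝓞 L)} (h₁ : σ • u₁.1 = w) (h₂ : σ • u₂.1 = w) :
    galAdicCompletionMap σ h₁ (x u₁) = galAdicCompletionMap σ h₂ (x u₂) := by
  subst h12; rfl

include hβ in
/-- **`Φ` intertwines the conjugations**: `Φ ∘ (c̄ ⊗ 1) = (c̄' ⊗ 1) ∘ Φ` for any `Φ` with the formula of `exists_localRingEquiv`, provided `β` commutes with the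
conjugations (`β (c̄'⁻¹ • w') = c̄⁻¹ • β w'`) — the naturality square of §2 at `(u, c̄'⁻¹ w') → (β w', w')` with `algebraMap ∘ c̄ = c̄' ∘ algebraMap` (§1).
[cite: CasselsFrohlichANT1967, Ch. VII §1.1] -/
theorem conjLocal_comm (Φ : LocalRing L 𝔭 ≃+* LocalRing L' 𝔓)
    (hΦ : ∀ (x : LocalRing L 𝔭) (w' : PlacesOver L' 𝔓), Φ x w' = toPlace (β w').1 (⟨w'.1, hβ w'⟩ : PlacesOver L' (β w').1) (x (β w')))
    (hβc : ∀ w' : PlacesOver L' 𝔓,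
      β (PlacesOver.galInv (IsCMField.complexConj L') w') = PlacesOver.galInv (IsCMField.complexConj L) (β w'))
    (x : LocalRing L 𝔭) :
    Φ (conjLocal L (IsCMField.complexConj L) 𝔭 x) = conjLocal L' (IsCMField.complexConj L') 𝔓 (Φ x) := by
  funext w'
  rw [hΦ, conjLocal_apply, conjLocal_apply, hΦ]
  -- the square at `u := β (c̄'⁻¹ • w')`, then move `u` to `c̄⁻¹ • β w'` along `hβc`
  set u : PlacesOver L 𝔭 := β (PlacesOver.galInv (IsCMField.complexConj L') w') with hu
  have hcu : IsCMField.complexConj L • u.1 = (β w').1 := by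
    rw [hu, hβc]
    exact smul_inv_smul _ _
  haveI := PlacesOver.liesOver (E := L') (⟨(PlacesOver.galInv (IsCMField.complexConj L') w').1, hβ _⟩ : PlacesOver L' u.1)
  haveI := PlacesOver.liesOver (E := L') (⟨w'.1, hβ w'⟩ : PlacesOver L' (β w').1)
  have hsq := galAdicCompletionMap_adicCompletionOfLiesOver_comm L L' (IsCMField.complexConj L) (IsCMField.complexConj L')
    (algebraMap_complexConj L L') (w₁ := u.1) (w₁' := (PlacesOver.galInv (IsCMField.complexConj L') w').1) (w₂ := (β w').1) (w₂' := w'.1)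
    hcu (smul_inv_smul (IsCMField.complexConj L') w'.1) (x u)
  -- `toPlace v w = adicCompletionOfLiesOver … v w.1` (definitional)
  change adicCompletionOfLiesOver L L' (β w').1 w'.1 _ = galAdicCompletionMap (IsCMField.complexConj L') _ (adicCompletionOfLiesOver L L' u.1 _ (x u))
  rw [hsq]
  congr 1
  exact galAdicCompletionMap_congr_place L 𝔭 (IsCMField.complexConj L) x (hβc w').symm _ _

include hβ in
omit [IsCMField L] [IsCMField L'] in
/-- **`Φ (h ⊗ 1) = (algebraMap L L' h) ⊗ 1`**: `Φ` extends `L → L'` on the diagonally embedded scalars (★ `toPlace_coe`). [cite: CasselsFrohlichANT1967, Ch. II §10] -/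
theorem map_algebraMap (Φ : LocalRing L 𝔭 ≃+* LocalRing L' 𝔓)
    (hΦ : ∀ (x : LocalRing L 𝔭) (w' : PlacesOver L' 𝔓), Φ x w' = toPlace (β w').1 (⟨w'.1, hβ w'⟩ : PlacesOver L' (β w').1) (x (β w')))
    (h : L) : Φ (algebraMap L (LocalRing L 𝔭) h) = algebraMap L' (LocalRing L' 𝔓) (algebraMap L L' h) := by
  funext w'
  rw [hΦ, Pi.algebraMap_apply, Pi.algebraMap_apply, ← adicCompletion_coe_eq_algebraMap (𝓞 L) L, toPlace_coe,
    adicCompletion_coe_eq_algebraMap (𝓞 L') L']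

include hβ in
omit [IsCMField L] [IsCMField L'] in
/-- … hence on Gram matrices: `Φ (H ⊗ 1) = (H.map (algebraMap L L')) ⊗ 1` (the `hΦH` of ★ `exists_cmDatum_local_equiv`). [cite: PlatonovRapinchuk1994, §5.1] -/
theorem map_gram {N : ℕ} (Φ : LocalRing L 𝔭 ≃+* LocalRing L' 𝔓)
    (hΦ : ∀ (x : LocalRing L 𝔭) (w' : PlacesOver L' 𝔓), Φ x w' = toPlace (β w').1 (⟨w'.1, hβ w'⟩ : PlacesOver L' (β w').1) (x (β w')))
    (H : Matrix (Fin N) (Fin N) L) :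
    (H.map (algebraMap L (LocalRing L 𝔭))).map Φ = (H.map (algebraMap L L')).map (algebraMap L' (LocalRing L' 𝔓)) := by
  exact Matrix.ext fun i j => by simpa only [Matrix.map_apply] using map_algebraMap L L' 𝔭 𝔓 β hβ Φ hΦ (H i j)

omit [IsCMField L] in
/-- `𝒪[L_w]` (the valuation ring of the valuative relation of `L_w`) is Mathlib's `adicCompletionIntegers` (compatible valuations). [folklore] -/
theorem mem_integer_iff (w : HeightOneSpectrum (𝓞 L)) (y : w.adicCompletion L) : y ∈ 𝒪[w.adicCompletion L] ↔ y ∈ w.adicCompletionIntegers L := by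
  rw [Valuation.mem_integer_iff, HeightOneSpectrum.mem_adicCompletionIntegers,
    ← Valuation.vle_one_iff (ValuativeRel.valuation (w.adicCompletion L)), Valuation.vle_one_iff (Valued.v : Valuation (w.adicCompletion L) _)]

include hβ in
omit [IsCMField L] [IsCMField L'] in
/-- **`Φ` matches integers**: `Φ x` is integral at every `w' ∣ 𝔓` iff `x` is integral at every `w ∣ 𝔭` (★ `toPlace_mem_adicCompletionIntegers_iff` componentwise,
`β` a bijection) — the `hΦ𝒪` of ★ `exists_cmDatum_local_equiv_level`. [cite: PlatonovRapinchuk1994, §5.1] -/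
theorem integral_iff (Φ : LocalRing L 𝔭 ≃+* LocalRing L' 𝔓)
    (hΦ : ∀ (x : LocalRing L 𝔭) (w' : PlacesOver L' 𝔓), Φ x w' = toPlace (β w').1 (⟨w'.1, hβ w'⟩ : PlacesOver L' (β w').1) (x (β w')))
    (x : LocalRing L 𝔭) :
    (∀ w' : PlacesOver L' 𝔓, Φ x w' ∈ 𝒪[(w'.1).adicCompletion L']) ↔ ∀ w : PlacesOver L 𝔭, x w ∈ 𝒪[(w.1).adicCompletion L] := by
  have key : ∀ w' : PlacesOver L' 𝔓, Φ x w' ∈ 𝒪[(w'.1).adicCompletion L'] ↔ x (β w') ∈ 𝒪[(β w').1.adicCompletion L] := fun w' => by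
    rw [hΦ, mem_integer_iff, mem_integer_iff]
    exact toPlace_mem_adicCompletionIntegers_iff (⟨w'.1, hβ w'⟩ : PlacesOver L' (β w').1) (x (β w'))
  simp only [key]
  refine ⟨fun h w => ?_, fun h w' => h (β w')⟩
  have h' := h (β.symm w)
  rwa [Equiv.apply_symm_apply] at h'

end Construction

/-! ## §4 Row 21's transport, discharged down to the place combinatorics `β` -/

section Assembly

variable (L L' : Type) [Field L] [NumberField L] [IsCMField L] [Field L'] [NumberField L'] [IsCMField L'] [Algebra L L'] (N : ℕ)
  (H : Matrix (Fin N) (Fin N) L)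
  (𝔭 : HeightOneSpectrum (𝓞 ↥(maximalRealSubfield L))) (𝔓 : HeightOneSpectrum (𝓞 ↥(maximalRealSubfield L')))
  (β : PlacesOver L' 𝔓 ≃ PlacesOver L 𝔭) (hβ : ∀ w' : PlacesOver L' 𝔓, (w'.1).under (𝓞 L) = (β w').1)
  (he : ∀ w' : PlacesOver L' 𝔓, (w'.1).asIdeal.ramificationIdx (𝓞 L) = 1)
  (hf : ∀ w' : PlacesOver L' 𝔓, (w'.1).asIdeal.inertiaDeg (𝓞 L) = 1)
  (hβc : ∀ w' : PlacesOver L' 𝔓,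
    β (PlacesOver.galInv (IsCMField.complexConj L') w') = PlacesOver.galInv (IsCMField.complexConj L) (β w'))

include hβ he hf hβc in
/-- **`U(H)(L⁺_𝔭) ≃ₜ* U(H)(L'⁺_𝔓)` with level matching, from the place data `β`** (★ `exists_cmDatum_local_equiv_level` fed the `Φ` of §3): there is
`e : (cmDatum L N H).Local 𝔭 ≃ₜ* (cmDatum L' N (H.map (algebraMap L L'))).Local 𝔓` (carriers `«local»`, ★ `cmDatum_Local` `rfl`), `e g = Φ(g)` entrywise, carrying
`U(H)(𝒪_𝔭)` ONTO `U(H)(𝒪_𝔓)`. [cite: Rogawski1990, §14.2 p. 232] [cite: PlatonovRapinchuk1994, §5.1] -/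
theorem exists_cmDatum_local_equiv_of_places :
    ∃ (Φ : LocalRing L 𝔭 ≃+* LocalRing L' 𝔓)
      (e : «local» L (IsCMField.complexConj L) N H 𝔭 ≃ₜ* «local» L' (IsCMField.complexConj L') N (H.map (algebraMap L L')) 𝔓),
      (∀ (x : LocalRing L 𝔭) (w' : PlacesOver L' 𝔓), Φ x w' = toPlace (β w').1 (⟨w'.1, hβ w'⟩ : PlacesOver L' (β w').1) (x (β w'))) ∧
      (∀ g, ((e g : «local» L' (IsCMField.complexConj L') N (H.map (algebraMap L L')) 𝔓) : GL (Fin N) (LocalRing L' 𝔓)) =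
        Matrix.GeneralLinearGroup.map (Φ : LocalRing L 𝔭 →+* LocalRing L' 𝔓) (g : GL (Fin N) (LocalRing L 𝔭))) ∧
      (cmLocalIntegralLevel L N H 𝔭).map
          (e : «local» L (IsCMField.complexConj L) N H 𝔭 →* «local» L' (IsCMField.complexConj L') N (H.map (algebraMap L L')) 𝔓) =
        cmLocalIntegralLevel L' N (H.map (algebraMap L L')) 𝔓 := by
  obtain ⟨Φ, hc, hc', hΦ⟩ := exists_localRingEquiv L L' 𝔭 𝔓 β hβ he hf
  obtain ⟨e, he', hlev⟩ := exists_cmDatum_local_equiv_level L L' N H (H.map (algebraMap L L')) 𝔭 𝔓 Φ hc hc'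
    (conjLocal_comm L L' 𝔭 𝔓 β hβ Φ hΦ hβc) (map_gram L L' 𝔭 𝔓 β hβ Φ hΦ H) (integral_iff L L' 𝔭 𝔓 β hβ Φ hΦ)
  exact ⟨Φ, e, hΦ, he', hlev⟩

include hβ he hf hβc in
/-- **ROW 21 «letter(L', 𝔓) ⇒ letter(L, 𝔭)», DISCHARGED TO THE PLACE DATA**: for CM `L ⊆ L'` and a degree-one bijection `β` of the places above `𝔓 ∣ 𝔭` commuting with the
conjugations, there is `e : (cmDatum L N H).Local 𝔭 ≃ₜ* (cmDatum L' N (H.map (algebraMap L L'))).Local 𝔓` along which ★ `IrrClass.comap` is a BIJECTION of irreducible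
classes preserving ADMISSIBILITY and carrying `U(H)(𝒪_𝔓)`-spherical classes exactly onto `U(H)(𝒪_𝔭)`-spherical ones («unramified ↔ unramified»).
[cite: Rogawski1990, §14.2 p. 232] [cite: PlatonovRapinchuk1994, §5.1] -/
theorem cm_letter_transport_of_places :
    ∃ e : (cmDatum L N H).Local 𝔭 ≃ₜ* (cmDatum L' N (H.map (algebraMap L L'))).Local 𝔓,
      Function.Bijective (IrrClass.comap e) ∧
      (∀ κ : IrrClass ((cmDatum L' N (H.map (algebraMap L L'))).Local 𝔓), (IrrClass.comap e κ).IsAdmissible ↔ κ.IsAdmissible) ∧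
      (∀ κ : IrrClass ((cmDatum L' N (H.map (algebraMap L L'))).Local 𝔓),
        (IrrClass.comap e κ).IsSpherical (cmLocalIntegralLevel L N H 𝔭) ↔
          κ.IsSpherical (cmLocalIntegralLevel L' N (H.map (algebraMap L L')) 𝔓)) := by
  obtain ⟨Φ, hc, hc', hΦ⟩ := exists_localRingEquiv L L' 𝔭 𝔓 β hβ he hf
  exact cm_letter_transport L L' N H (H.map (algebraMap L L')) 𝔭 𝔓 Φ hc hc' (conjLocal_comm L L' 𝔭 𝔓 β hβ Φ hΦ hβc)
    (map_gram L L' 𝔭 𝔓 β hβ Φ hΦ H) (integral_iff L L' 𝔭 𝔓 β hβ Φ hΦ)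

end Assembly

end Summit.HodgeConjecture.HodgeConjecture.Cruxes.H413.K2E1GroundFieldChangeLocalRingIso

end
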